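import Literature.Computability.AlgebraicComplexity.SymmetricCircuitLinCombOutputs
import HarnessLib

/-!
# Symmetric circuits: output-wise linear combinations of two output families (symmetry and size)

Topic `Computability/AlgebraicComplexity`, namespace `Literature.Computability.AlgebraicComplexity`.
Continuation of `SymmetricCircuitLinCombOutputs.lean` (the gadget
`LabelledArithCircuit.LinCombOutputs.circuit` built on a Dawar–Wilsenach labelled circuit `P`
with outputs indexed by `Y₀`, two index maps `l r : Y → Y₀` and constants `a`, `b`; A. Dawar,
G. Wilsenach, *Symmetric Arithmetic Circuits*, Theory of Computing 21 (2025), Defs. 2.2, 3.6,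
3.7):

* SYMMETRY (`isAutomorphismExtending_perm`, `isSymmetric_circuit`): an automorphism `π` of `P`
  extending `γ` (Def. 3.6) extends to the gadget by the identity on the constant sources and on
  `sa`, `sb` (constant gates are fixed by every automorphism,
  `IsAutomorphismExtending.apply_eq_self_of_label_const`) and by `ma y ↦ ma (γ • y)`,
  `mb y ↦ mb (γ • y)`, `out y ↦ out (γ • y)` on the output layers, as soon as `l` and `r` are
  `γ`-equivariant (`P.output (l (γ • y)) = P.output (γ • l y) = π (P.output (l y))`); so a
  `Γ`-symmetric `P` (Def. 3.7) with `Γ`-equivariant `l`, `r` gives a `Γ`-symmetric gadget;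
* SIZE (`card_gate_le`): at most `|G| + 3 · |Y| + 4` gates;
* the packaged statement `LabelledArithCircuit.IsSymmetric.exists_linCombOutputs` for a
  `Γ`-symmetric circuit with outputs `Y ⊕ Y` (`l = Sum.inl`, `r = Sum.inr`, equivariant for
  Mathlib's sum action `Sum.smul_inl`, `Sum.smul_inr`).

Everything is folklore and proved; nothing here is a named fact.
-/

noncomputable section

open scoped Classical

namespace Literature.Computability.AlgebraicComplexity

open MvPolynomial

universe u v w z z₀

namespace LabelledArithCircuit

namespace LinCombOutputs

variable {K : Type u} {X : Type v} {Y₀ : Type z₀} {Y : Type z} {G : Type w}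
  {P : LabelledArithCircuit K X Y₀ G} {l r : Y → Y₀} {a b : K}

/-! ### Symmetry -/

section Symmetry

variable {Γ : Type*} [Group Γ] [MulAction Γ X] [MulAction Γ Y₀] {γ : Γ} {π : Equiv.Perm G}

/-- Constant sources are fixed by the extension `LinCombOutGate.perm π σ` of an automorphism `π`
of `P` (constant gates are fixed by automorphisms, Def. 3.6). [cite: DawarWilsenach2025, Def. 3.6] -/
theorem perm_csrc (hπ : P.IsAutomorphismExtending γ π) (σ : Equiv.Perm Y) (c : K)
    (hc : c ∈ LinComb.cset a b) :
    LinCombOutGate.perm π σ (csrc c hc : Gate P Y a b) = csrc c hc := by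
  unfold csrc
  split_ifs with h
  · change LinCombOutGate.old (π h.choose) = LinCombOutGate.old h.choose
    rw [hπ.apply_eq_self_of_label_const h.choose_spec]
  · rfl

variable [MulAction Γ Y]

/-- **Symmetry.** If `π` is an automorphism of `P` extending `γ` and the index maps `l`, `r` are
`γ`-equivariant, then `π` extended by the identity on the constant sources and `sa`, `sb` and by
`γ` on the output layers is an automorphism of the output-wise linear-combination circuit
extending `γ`. [cite: DawarWilsenach2025, Def. 3.6] -/
theorem isAutomorphismExtending_perm (hπ : P.IsAutomorphismExtending γ π)
    (hl : ∀ y, l (γ • y) = γ • l y) (hr : ∀ y, r (γ • y) = γ • r y) :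
    (circuit P l r a b).IsAutomorphismExtending γ
      (LinCombOutGate.perm π (MulAction.toPerm γ)) := by
  refine ⟨fun s => ?_, fun s => ?_, fun _ => rfl⟩
  · cases s with
    | old g =>
      change (P.children (π g)).map LinCombOutGate.oldEmb =
        ((P.children g).map LinCombOutGate.oldEmb).map
          (LinCombOutGate.perm π (MulAction.toPerm γ)).toEmbedding
      rw [hπ.children_apply, Finset.map_map, Finset.map_map]
      rfl
    | ncst c => exact (Finset.map_empty _).symm
    | sa =>
      change ({csrc a (LinComb.mem_cset a b).1} : Finset (Gate P Y a b)) =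
        ({csrc a (LinComb.mem_cset a b).1} : Finset (Gate P Y a b)).map
          (LinCombOutGate.perm π (MulAction.toPerm γ)).toEmbedding
      rw [Finset.map_singleton, Equiv.coe_toEmbedding, perm_csrc hπ]
    | sb =>
      change ({csrc b (LinComb.mem_cset a b).2} : Finset (Gate P Y a b)) =
        ({csrc b (LinComb.mem_cset a b).2} : Finset (Gate P Y a b)).map
          (LinCombOutGate.perm π (MulAction.toPerm γ)).toEmbedding
      rw [Finset.map_singleton, Equiv.coe_toEmbedding, perm_csrc hπ]
    | ma y =>
      change ({LinCombOutGate.sa, LinCombOutGate.old (P.output (l (γ • y)))} :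
          Finset (Gate P Y a b)) =
        ({LinCombOutGate.sa, LinCombOutGate.old (P.output (l y))} : Finset (Gate P Y a b)).map
          (LinCombOutGate.perm π (MulAction.toPerm γ)).toEmbedding
      rw [Finset.map_insert, Finset.map_singleton, Equiv.coe_toEmbedding, hl, hπ.output_smul]
      rfl
    | mb y =>
      change ({LinCombOutGate.sb, LinCombOutGate.old (P.output (r (γ • y)))} :
          Finset (Gate P Y a b)) =
        ({LinCombOutGate.sb, LinCombOutGate.old (P.output (r y))} : Finset (Gate P Y a b)).map
          (LinCombOutGate.perm π (MulAction.toPerm γ)).toEmbedding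
      rw [Finset.map_insert, Finset.map_singleton, Equiv.coe_toEmbedding, hr, hπ.output_smul]
      rfl
    | out y =>
      change ({LinCombOutGate.ma (γ • y), LinCombOutGate.mb (γ • y)} : Finset (Gate P Y a b)) =
        ({LinCombOutGate.ma y, LinCombOutGate.mb y} : Finset (Gate P Y a b)).map
          (LinCombOutGate.perm π (MulAction.toPerm γ)).toEmbedding
      rw [Finset.map_insert, Finset.map_singleton]
      rfl
  · cases s with
    | old g => exact hπ.label_apply g
    | _ => rfl

/-- A `Γ`-symmetric `P` with `Γ`-equivariant index maps `l`, `r` gives a `Γ`-symmetric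
output-wise linear-combination circuit (Def. 3.7). [cite: DawarWilsenach2025, Def. 3.7] -/
theorem isSymmetric_circuit (hsym : P.IsSymmetric Γ) (hl : ∀ (γ : Γ) (y : Y), l (γ • y) = γ • l y)
    (hr : ∀ (γ : Γ) (y : Y), r (γ • y) = γ • r y) : (circuit P l r a b).IsSymmetric Γ := by
  intro γ
  obtain ⟨π, hπ⟩ := hsym γ
  exact ⟨LinCombOutGate.perm π (MulAction.toPerm γ), isAutomorphismExtending_perm hπ (hl γ) (hr γ)⟩

end Symmetry

/-! ### Size -/

/-- **Size.** The output-wise linear-combination circuit has at most `|G| + 3 · |Y| + 4` gates.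
[cite: DawarWilsenach2025, Def. 2.2 (size)] -/
theorem card_gate_le [Fintype G] [Fintype Y] :
    Fintype.card (Gate P Y a b) ≤ Fintype.card G + 3 * Fintype.card Y + 4 := by
  rw [Fintype.card_congr LinCombOutGate.equivSum]
  simp only [Fintype.card_sum, Fintype.card_bool]
  have h := LinComb.card_NC_le (P := P) (a := a) (b := b)
  omega

end LinCombOutputs

/-- **Output-wise linear combinations of symmetric circuits.** For any group `Γ` acting on the
variables `X` and on the output indices `Y`: a `Γ`-symmetric labelled circuit `C` over `K`, `X`
with outputs indexed by `Y ⊕ Y` (two equivariant output families `A_y = out_{inl y}`,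
`B_y = out_{inr y}`) and constants `a, b ∈ K` yield a `Γ`-symmetric labelled circuit with outputs
indexed by `Y` computing `y ↦ a · A_y + b · B_y`, with at most `|G| + 3 · |Y| + 4` gates
(post-compose with `LinCombOutputs.circuit C Sum.inl Sum.inr a b`; Dawar–Wilsenach Defs. 2.2,
3.6, 3.7). [cite: DawarWilsenach2025, Def. 3.7] -/
theorem IsSymmetric.exists_linCombOutputs {K : Type u} [CommSemiring K] {X : Type v} {Y : Type z}
    {Γ : Type*} [Group Γ] [MulAction Γ X] [MulAction Γ Y] [Fintype Y] {G : Type w} [Fintype G]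
    (C : LabelledArithCircuit K X (Y ⊕ Y) G) (hC : C.IsSymmetric Γ) (a b : K) :
    ∃ (G' : Type (max u w z)) (_ : Fintype G') (C' : LabelledArithCircuit K X Y G'),
      C'.IsSymmetric Γ ∧
      (∀ y, C'.eval (C'.output y) =
        MvPolynomial.C a * C.eval (C.output (Sum.inl y)) +
          MvPolynomial.C b * C.eval (C.output (Sum.inr y))) ∧
      Fintype.card G' ≤ Fintype.card G + 3 * Fintype.card Y + 4 :=
  ⟨LinCombOutputs.Gate C Y a b, inferInstance, LinCombOutputs.circuit C Sum.inl Sum.inr a b,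
    LinCombOutputs.isSymmetric_circuit hC (fun γ y => (Sum.smul_inl γ y).symm)
      (fun γ y => (Sum.smul_inr γ y).symm),
    LinCombOutputs.eval_output, LinCombOutputs.card_gate_le⟩

end LabelledArithCircuit

end Literature.Computability.AlgebraicComplexity

end
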